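import Mathlib
import HarnessLib
import Literature.Analysis.FluidPDE.TaoCascadeNoLow
import Literature.Analysis.FluidPDE.Tao2016AveragedNS.RestartedCascadeFlows

/-!
# `CompletionRelayChain` — crux `RelayFrontStep` (item stmt-NavierStokesRegularity-24850):
  THE RELAY FLUX — the bond flux of the completion-relay lattice goes through triggers and relays only
  (helper for LINE `window_v2`, stub `stub_tail`)

For a table `α` whose cascade nonlinearity `quadTerm 1 α` has the completion-relay rows, the energy
identity `∑ᵢ quadTerm_{i,n}·X_{i,n} = Φ_{n−1} − Φ_n` holds for EVERY family `X` with the explicit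
RELAY FLUX

  `Φ_n = Λ_n · u_n · (u_n·x_{n+1} + (1/32)·r_n·u_{n+1})`,  `Λ_n = 2^{5n/2}`, `(x,u,r) = (X 0, X 1, X 2)`

(`sum_quadTerm_mul_self_of_relayRows`: pure algebra of the rows). If `α` is moreover cancelling
(4.3) — every table of the crux is, `InTableClass 64 α` — the tree identity
`∑ᵢ quadTerm_{i,n}·X_{i,n} = topSum(n) + botSum(n−1) = botSum(n−1) − botSum(n)`
(`TaoCascade.sum_quadTerm_mul`, `TaoCascade.botSum_eq_neg_topSum`) and a two-shell truncation of the
family identify the tree's bond flux with the relay flux: **`botSum 1 α X n t = Φ_n`**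
(`botSum_eq_relayFlux`). Consequently the bond flux through `n | n+1` is controlled by the trigger and
relay amplitudes of the LOWER shell alone — NOT by its carrier —
`|botSum 1 α X n t| ≤ Λ_n (u_n² + |r_n u_n|/32) · max(|x_{n+1}|, |u_{n+1}|)` (`abs_botSum_relay_le`),
which is what makes the far-ahead energy clauses of the repaired window `W₂` re-enter behind an ACTIVE
next-next shell (carrier `0.09`, trigger `≤ 2e-6`): every tail lemma of the tree stated over `botSum`
(`GappedFrontRobust.pseudoFlowOn_block_energy_le`, `…_tail_energy_le`, `…_abs_le_tail_step`) can now be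
fed the sharp relay flux (census `Cruxes/RelayFrontStep/REPAIR-CENSUS-crc-p1.md` §4, S2).

No definitions (the flux is spelled out). HONEST FRAMING: finite algebra of a MODEL lattice table
(Tao 2016 §4 (4.3), proof of (4.13)); helper for the crux, no stub credit; nothing here is a statement
about the Navier–Stokes equations; no summit, rung or crux is proved.
-/

noncomputable section

-- the summit-side namespace `Summit.NavierStokesRegularity.NavierStokesRegularity.…` (single-conjunct summit,
-- D-0017) repeats a component by design; the dupNamespace linter would flag every declaration.
set_option linter.dupNamespace false

open Set Literature.Analysis.FluidPDE Literature.Analysis.FluidPDE.TaoCascade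

namespace Summit.NavierStokesRegularity.NavierStokesRegularity.Theorems

namespace RelayFrontStep

variable {α : Fin 4 → Fin 4 → Fin 4 → ℤ × ℤ × ℤ → ℝ}

/-- **The energy identity of the relay rows.** For every family `X`, shell `n` and time `t`:
`∑ᵢ quadTerm 1 α X i n t · X i n t = Φ_{n−1} − Φ_n` with the relay flux
`Φ_n = 2^{5n/2} u_n (u_n x_{n+1} + r_n u_{n+1}/32)` (spelled out; at `n−1` the carrier of shell `n`
appears as `X 0 n t`). Pure algebra of the four rows. [this file] -/
theorem sum_quadTerm_mul_self_of_relayRows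
    (hrows : (∀ (X : Fin 4 → ℤ → ℝ → ℝ) (n : ℤ) (t : ℝ), quadTerm 1 α X 0 n t =
        -((1 + 1 : ℝ) ^ ((5 : ℝ) * n / 2) * (X 1 n t * X 1 n t)) +
          (1 + 1 : ℝ) ^ ((5 : ℝ) * ((n : ℝ) - 1) / 2) * (X 1 (n - 1) t * X 1 (n - 1) t)) ∧
      (∀ (X : Fin 4 → ℤ → ℝ → ℝ) (n : ℤ) (t : ℝ), quadTerm 1 α X 1 n t =
        (1 + 1 : ℝ) ^ ((5 : ℝ) * n / 2) * (X 0 n t * X 1 n t - X 1 n t * X 0 (n + 1) t) -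
          (1 / 32 : ℝ) * ((1 + 1 : ℝ) ^ ((5 : ℝ) * n / 2) * (X 0 (n + 1) t * X 2 n t)) +
          (1 / 32 : ℝ) * ((1 + 1 : ℝ) ^ ((5 : ℝ) * ((n : ℝ) - 1) / 2) *
            (X 2 (n - 1) t * X 1 (n - 1) t))) ∧
      (∀ (X : Fin 4 → ℤ → ℝ → ℝ) (n : ℤ) (t : ℝ), quadTerm 1 α X 2 n t =
        (1 / 32 : ℝ) * ((1 + 1 : ℝ) ^ ((5 : ℝ) * n / 2) *
          (X 0 (n + 1) t * X 1 n t - X 1 n t * X 1 (n + 1) t))) ∧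
      (∀ (X : Fin 4 → ℤ → ℝ → ℝ) (n : ℤ) (t : ℝ), quadTerm 1 α X 3 n t = 0))
    (X : Fin 4 → ℤ → ℝ → ℝ) (n : ℤ) (t : ℝ) :
    ∑ i, quadTerm 1 α X i n t * X i n t =
      (1 + 1 : ℝ) ^ ((5 : ℝ) * ((n : ℝ) - 1) / 2) * X 1 (n - 1) t *
          (X 1 (n - 1) t * X 0 n t + (1 / 32 : ℝ) * X 2 (n - 1) t * X 1 n t) -
        (1 + 1 : ℝ) ^ ((5 : ℝ) * n / 2) * X 1 n t *
          (X 1 n t * X 0 (n + 1) t + (1 / 32 : ℝ) * X 2 n t * X 1 (n + 1) t) := by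
  obtain ⟨h0, h1, h2, h3⟩ := hrows
  simp only [Fin.sum_univ_four, h0 X n t, h1 X n t, h2 X n t, h3 X n t]
  -- `Fin.sum_univ_four` produces the modes as `0, 1, 2, 3`
  ring

/-- **The tree's bond flux IS the relay flux.** For a CANCELLING table with the completion-relay rows,
`botSum 1 α X n t = 2^{5n/2} u_n (u_n x_{n+1} + r_n u_{n+1}/32)` for every family, shell and time.
Proof: both sides depend only on the family at shells `n, n+1`; on the two-shell truncation `X'` the
tree identity `∑ᵢ quadTerm·X = botSum(n) − botSum(n+1)` at shell `n+1` (cancellation) and the row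
identity `= Φ_n − Φ_{n+1}` have vanishing top terms. [this file] -/
theorem botSum_eq_relayFlux (hα : IsCancellingCoeff α)
    (hrows : (∀ (X : Fin 4 → ℤ → ℝ → ℝ) (n : ℤ) (t : ℝ), quadTerm 1 α X 0 n t =
        -((1 + 1 : ℝ) ^ ((5 : ℝ) * n / 2) * (X 1 n t * X 1 n t)) +
          (1 + 1 : ℝ) ^ ((5 : ℝ) * ((n : ℝ) - 1) / 2) * (X 1 (n - 1) t * X 1 (n - 1) t)) ∧
      (∀ (X : Fin 4 → ℤ → ℝ → ℝ) (n : ℤ) (t : ℝ), quadTerm 1 α X 1 n t =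
        (1 + 1 : ℝ) ^ ((5 : ℝ) * n / 2) * (X 0 n t * X 1 n t - X 1 n t * X 0 (n + 1) t) -
          (1 / 32 : ℝ) * ((1 + 1 : ℝ) ^ ((5 : ℝ) * n / 2) * (X 0 (n + 1) t * X 2 n t)) +
          (1 / 32 : ℝ) * ((1 + 1 : ℝ) ^ ((5 : ℝ) * ((n : ℝ) - 1) / 2) *
            (X 2 (n - 1) t * X 1 (n - 1) t))) ∧
      (∀ (X : Fin 4 → ℤ → ℝ → ℝ) (n : ℤ) (t : ℝ), quadTerm 1 α X 2 n t =
        (1 / 32 : ℝ) * ((1 + 1 : ℝ) ^ ((5 : ℝ) * n / 2) *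
          (X 0 (n + 1) t * X 1 n t - X 1 n t * X 1 (n + 1) t))) ∧
      (∀ (X : Fin 4 → ℤ → ℝ → ℝ) (n : ℤ) (t : ℝ), quadTerm 1 α X 3 n t = 0))
    (X : Fin 4 → ℤ → ℝ → ℝ) (n : ℤ) (t : ℝ) :
    botSum 1 α X n t =
      (1 + 1 : ℝ) ^ ((5 : ℝ) * n / 2) * X 1 n t *
        (X 1 n t * X 0 (n + 1) t + (1 / 32 : ℝ) * X 2 n t * X 1 (n + 1) t) := by
  classical
  -- the two-shell truncation of the family
  set X' : Fin 4 → ℤ → ℝ → ℝ := fun i m s => if m = n ∨ m = n + 1 then X i m s else 0 with hX'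
  have hn : ∀ i s, X' i n s = X i n s := fun i s => by simp [hX']
  have hn1 : ∀ i s, X' i (n + 1) s = X i (n + 1) s := fun i s => by simp [hX']
  have hn2 : ∀ i s, X' i (n + 1 + 1) s = 0 := fun i s => by
    have h1 : ¬ (n + 1 + 1 = n ∨ n + 1 + 1 = n + 1) := by omega
    simp only [hX']
    exact if_neg h1
  -- both sides agree with their values on `X'`
  have hL : botSum 1 α X n t = botSum 1 α X' n t := by
    simp only [botSum, hn, hn1]
  have hR : (1 + 1 : ℝ) ^ ((5 : ℝ) * n / 2) * X 1 n t *
        (X 1 n t * X 0 (n + 1) t + (1 / 32 : ℝ) * X 2 n t * X 1 (n + 1) t) =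
      (1 + 1 : ℝ) ^ ((5 : ℝ) * n / 2) * X' 1 n t *
        (X' 1 n t * X' 0 (n + 1) t + (1 / 32 : ℝ) * X' 2 n t * X' 1 (n + 1) t) := by
    simp only [hn, hn1]
  -- on `X'` the fluxes through the upper bond `n+1 | n+2` vanish
  have htop : botSum 1 α X' (n + 1) t = 0 := by
    simp only [botSum, hn2, mul_zero, Finset.sum_const_zero]
  -- the tree identity at shell `n+1`: `∑ᵢ quadTerm·X' = topSum(n+1) + botSum(n) = botSum(n) − botSum(n+1)`
  have htree := sum_quadTerm_mul 1 α X' (n + 1) t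
  have htop' : topSum 1 α X' (n + 1) t = 0 := by
    have := botSum_eq_neg_topSum 1 hα X' (n + 1) t
    linarith
  -- the row identity at shell `n+1`
  have hrow := sum_quadTerm_mul_self_of_relayRows hrows X' (n + 1) t
  have hcast : (((n + 1 : ℤ) : ℝ) - 1) = (n : ℝ) := by push_cast; ring
  rw [hcast, add_sub_cancel_right] at hrow
  rw [htop', zero_add, add_sub_cancel_right] at htree
  -- compare
  rw [hL, hR, ← htree, hrow, hn2 0 t, hn2 1 t]
  ring

/-- **Size of the relay flux**: through the bond `n | n+1` (`n` arbitrary),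
`|botSum 1 α X n t| ≤ 2^{5n/2} (u_n² + |r_n u_n|/32) · Q` whenever `|x_{n+1}|, |u_{n+1}| ≤ Q` — the
trigger and relay of the LOWER shell and any common bound `Q ≥ 0` on the carrier and trigger of the
upper shell (any `Q`; the hypotheses force `Q ≥ 0`); the lower shell's carrier does not enter.
[this file] -/
theorem abs_botSum_relay_le (hα : IsCancellingCoeff α)
    (hrows : (∀ (X : Fin 4 → ℤ → ℝ → ℝ) (n : ℤ) (t : ℝ), quadTerm 1 α X 0 n t =
        -((1 + 1 : ℝ) ^ ((5 : ℝ) * n / 2) * (X 1 n t * X 1 n t)) +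
          (1 + 1 : ℝ) ^ ((5 : ℝ) * ((n : ℝ) - 1) / 2) * (X 1 (n - 1) t * X 1 (n - 1) t)) ∧
      (∀ (X : Fin 4 → ℤ → ℝ → ℝ) (n : ℤ) (t : ℝ), quadTerm 1 α X 1 n t =
        (1 + 1 : ℝ) ^ ((5 : ℝ) * n / 2) * (X 0 n t * X 1 n t - X 1 n t * X 0 (n + 1) t) -
          (1 / 32 : ℝ) * ((1 + 1 : ℝ) ^ ((5 : ℝ) * n / 2) * (X 0 (n + 1) t * X 2 n t)) +
          (1 / 32 : ℝ) * ((1 + 1 : ℝ) ^ ((5 : ℝ) * ((n : ℝ) - 1) / 2) *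
            (X 2 (n - 1) t * X 1 (n - 1) t))) ∧
      (∀ (X : Fin 4 → ℤ → ℝ → ℝ) (n : ℤ) (t : ℝ), quadTerm 1 α X 2 n t =
        (1 / 32 : ℝ) * ((1 + 1 : ℝ) ^ ((5 : ℝ) * n / 2) *
          (X 0 (n + 1) t * X 1 n t - X 1 n t * X 1 (n + 1) t))) ∧
      (∀ (X : Fin 4 → ℤ → ℝ → ℝ) (n : ℤ) (t : ℝ), quadTerm 1 α X 3 n t = 0))
    (X : Fin 4 → ℤ → ℝ → ℝ) (n : ℤ) (t : ℝ) {Q : ℝ}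
    (hx : |X 0 (n + 1) t| ≤ Q) (hu : |X 1 (n + 1) t| ≤ Q) :
    |botSum 1 α X n t| ≤
      (1 + 1 : ℝ) ^ ((5 : ℝ) * n / 2) * (X 1 n t ^ 2 + |X 2 n t * X 1 n t| / 32) * Q := by
  rw [botSum_eq_relayFlux hα hrows X n t]
  have hΛ : 0 ≤ (1 + 1 : ℝ) ^ ((5 : ℝ) * n / 2) := (Real.rpow_pos_of_pos (by norm_num) _).le
  set u := X 1 n t
  set r := X 2 n t
  set x' := X 0 (n + 1) t
  set u' := X 1 (n + 1) t
  have h1 : |u * (u * x')| ≤ u ^ 2 * Q := by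
    rw [abs_mul, abs_mul, ← mul_assoc, abs_mul_abs_self, ← sq]
    exact mul_le_mul_of_nonneg_left hx (sq_nonneg u)
  have h2 : |u * ((1 / 32 : ℝ) * r * u')| ≤ |r * u| / 32 * Q := by
    have : u * ((1 / 32 : ℝ) * r * u') = (r * u) * u' / 32 := by ring
    rw [this, abs_div, abs_mul, abs_of_pos (by norm_num : (0 : ℝ) < 32)]
    have := mul_le_mul_of_nonneg_left hu (abs_nonneg (r * u))
    calc |r * u| * |u'| / 32 ≤ |r * u| * Q / 32 := by gcongr
      _ = |r * u| / 32 * Q := by ring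
  calc |(1 + 1 : ℝ) ^ ((5 : ℝ) * n / 2) * u * (u * x' + (1 / 32 : ℝ) * r * u')|
      = (1 + 1 : ℝ) ^ ((5 : ℝ) * n / 2) * |u * (u * x') + u * ((1 / 32 : ℝ) * r * u')| := by
        rw [show (1 + 1 : ℝ) ^ ((5 : ℝ) * n / 2) * u * (u * x' + (1 / 32 : ℝ) * r * u') =
            (1 + 1 : ℝ) ^ ((5 : ℝ) * n / 2) * (u * (u * x') + u * ((1 / 32 : ℝ) * r * u')) by ring,
          abs_mul, abs_of_nonneg hΛ]
    _ ≤ (1 + 1 : ℝ) ^ ((5 : ℝ) * n / 2) * (u ^ 2 * Q + |r * u| / 32 * Q) := by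
        refine mul_le_mul_of_nonneg_left ((abs_add_le _ _).trans (add_le_add h1 h2)) hΛ
    _ = (1 + 1 : ℝ) ^ ((5 : ℝ) * n / 2) * (u ^ 2 + |r * u| / 32) * Q := by ring

end RelayFrontStep

end Summit.NavierStokesRegularity.NavierStokesRegularity.Theorems
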